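import Literature.Analysis.UnboundedOperators.HeatKernelGradient
import Literature.Analysis.UnboundedOperators.HeatKernelHeatEquation
import Mathlib.Analysis.Calculus.MeanValue
import HarnessLib

/-!
# Gaussian asymptotics of the heat semigroup with explicit constants

For the caloric extension `u(t) = e^{tΔ}f = G_t ⋆ f` of an integrable `f` on a finite-dimensional
real inner product space `E` (`n = dim E`, `G_t(x) = (4πt)^{-n/2}e^{-‖x‖²/4t}`, the tree's
`Literature.Analysis.UnboundedOperators.heatKernel` / `heatExtension`), the solution looks, for large
`t`, like the total mass times the kernel: `u(x, t) ≈ M G_t(x)`, `M = ∫ f`. This file proves the two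
quantitative forms of this statement under moment hypotheses, WITH EXPLICIT CONSTANTS (the printed
versions carry unspecified `C = C(N)`):

* `norm_heatExtension_le_mul_integral_norm` — the `L¹ → L^∞` smoothing bound, pointwise and with the
  sharp constant: `‖e^{tΔ}f(x)‖ ≤ (4πt)^{-n/2} ∫‖f‖` (Vázquez 2017, §1 Exercise 9 (i), `p = 1`).
* `abs_heatKernel_sub_sub_heatKernel_le` — the kernel increment
  `|G_t(x - y) - G_t(x)| ≤ (4πt)^{-n/2} t^{-1/2} ‖y‖` (mean value inequality with the tree's gradient
  bound `norm_fderiv_heatKernel_le`).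
* **`norm_heatExtension_sub_heatKernel_smul_integral_le`** — Vázquez 2017, Theorem 4.1 (first absolute
  moment; the method of Duoandikoetxea–Zuazua 1992):
  `‖e^{tΔ}f(x) - G_t(x)•∫f‖ ≤ (4πt)^{-n/2} t^{-1/2} ∫‖y‖‖f(y)‖dy`, i.e. the printed
  `t^{N/2}|u(x,t) - MG_t(x)| ≤ C 𝒩₁ t^{-1/2}` with `C = (4π)^{-N/2}`.
* `abs_heatKernel_taylor_two_le` — the second-order kernel remainder
  `|G_t(x - y) - G_t(x) - G_t(x)⟪x, y⟫/(2t)| ≤ (4πt)^{-n/2} ‖y‖²/(2t)` (the one-variable function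
  `s ↦ G_t(x - sy) = (4πt)^{-n/2}exp(-‖x - sy‖²/4t)` has `|φ''| ≤ (4πt)^{-n/2}‖y‖²/t` because
  `e^{-v}(v + ½) ≤ 1`).
* **`norm_heatExtension_sub_heatKernel_smul_integral_le_of_centred`** — Vázquez 2017, Theorem 5.1 in its
  centred form (the first signed moments vanish, `∫⟪v, y⟫•f(y)dy = 0` for every `v`; "the center of
  mass can be reduced to zero by just a displacement of the spatial axis"):
  `‖e^{tΔ}f(x) - G_t(x)•∫f‖ ≤ (4πt)^{-n/2} (2t)⁻¹ ∫‖y‖²‖f(y)‖dy` — the printed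
  `t^{N/2}|u - MG_t| ≤ C 𝒩₂ t^{-1}` with `C = (4π)^{-N/2}/2`; and its corollary
  `…_of_even` for even data `f(-y) = f(y)` (e.g. radial data), which are automatically centred.

Design: the moment hypotheses are stated as `Integrable (fun y => ‖y‖ * ‖f y‖)` /
`Integrable (fun y => ‖y‖ ^ 2 * ‖f y‖)`; `f` takes values in a real Banach space `F` (the mass is
`∫ f ∈ F` and `M G_t(x)` is `G_t(x) • ∫ f`). The `L¹` forms of Theorems 4.1/5.1 and the optimality of
the rates are not typed here. Consumer: `Literature/Analysis/FluidPDE/StrainedEddyRelaxationRate.lean`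
(the rate at which Majda–Bertozzi's strained viscous eddy relaxes to the Burgers vortex).

## References
* [Vazquez2017] J. L. Vázquez, *Asymptotic behaviour methods for the Heat Equation. Convergence to
  the Gaussian*, arXiv:1706.10034 (2017), §1 Exercise 9, Theorem 4.1, Theorem 5.1.
* J. Duoandikoetxea, E. Zuazua, *Moments, masses de Dirac et décomposition de fonctions*,
  C. R. Acad. Sci. Paris Sér. I 315 (1992) 693–698 (the moment method; cited in [Vazquez2017]).
-/

open MeasureTheory Filter Topology Set
open scoped Real ENNReal NNReal Convolution RealInnerProductSpace

noncomputable section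

namespace Literature.Analysis.UnboundedOperators

variable {E : Type*} [NormedAddCommGroup E] [InnerProductSpace ℝ E] [FiniteDimensional ℝ E]
  [MeasurableSpace E] [BorelSpace E]
variable {F : Type*} [NormedAddCommGroup F] [NormedSpace ℝ F]

/-! ### Pointwise smoothing and the kernel increment -/

/-- **`L¹ → L^∞` smoothing with the sharp constant, pointwise**: for `f ∈ L¹(E, F)`, `t > 0` and
every `x`, `‖e^{tΔ}f(x)‖ ≤ (4πt)^{-n/2} ∫‖f‖` (the kernel is bounded by its value at the origin,
`heatKernel_le`). Vázquez: "prove that there exists a constant `C = C(p, N)` such that for every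
`u₀ ∈ Lᵖ(ℝᴺ)`, `‖u(t)‖_∞ ≤ C‖u₀‖_p t^{-N/2p}`" — here `p = 1`, `C = (4π)^{-N/2}`.
[cite: Vazquez2017, §1 Exercise 9 (i)] -/
theorem norm_heatExtension_le_mul_integral_norm {f : E → F} (hf : Integrable f) {t : ℝ}
    (ht : 0 < t) (x : E) :
    ‖heatExtension f t x‖ ≤ (4 * π * t) ^ (-(Module.finrank ℝ E : ℝ) / 2) * ∫ y, ‖f y‖ := by
  rw [heatExtension_eq_integral_sub, ← MeasureTheory.integral_const_mul]
  refine norm_integral_le_of_norm_le (hf.norm.const_mul _) (Eventually.of_forall fun y => ?_)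
  rw [norm_smul, Real.norm_of_nonneg (heatKernel_pos ht _).le]
  exact mul_le_mul_of_nonneg_right (heatKernel_le ht _) (norm_nonneg _)

omit [FiniteDimensional ℝ E] [MeasurableSpace E] [BorelSpace E] in
/-- The gradient bound of the Gauss kernel without its Gaussian factor:
`‖∇G_t(z)‖ ≤ (4πt)^{-n/2} t^{-1/2}` for `t > 0` (from the tree's `norm_fderiv_heatKernel_le`,
`‖∇G_t(z)‖ ≤ (4πt)^{-n/2}t^{-1/2}e^{-‖z‖²/8t}`). [cite: Vazquez2017, Theorem 4.1 (proof, step (ii))] -/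
theorem norm_fderiv_heatKernel_le_rpow {t : ℝ} (ht : 0 < t) (z : E) :
    ‖fderiv ℝ (heatKernel t) z‖ ≤
      (4 * π * t) ^ (-(Module.finrank ℝ E : ℝ) / 2) * (Real.sqrt t)⁻¹ := by
  refine (norm_fderiv_heatKernel_le ht z).trans ?_
  refine mul_le_of_le_one_right (by positivity) ?_
  rw [Real.exp_le_one_iff, neg_mul]
  have : 0 ≤ 1 / (8 * t) * ‖z‖ ^ 2 := by positivity
  linarith

omit [FiniteDimensional ℝ E] [MeasurableSpace E] [BorelSpace E] in
/-- **The kernel increment**: `|G_t(x - y) - G_t(x)| ≤ (4πt)^{-n/2} t^{-1/2} ‖y‖` for `t > 0`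
(mean value inequality on the segment, `‖∇G_t‖ ≤ (4πt)^{-n/2}t^{-1/2}`). Vázquez, proof of
Theorem 4.1: `G_t(x - y) - G_t(x) = ∫₀¹ ∂_s(G_t(x - sy))ds` with the vector function
`ξe^{-|ξ|²/4}` "bounded by a numerical constant". [cite: Vazquez2017, Theorem 4.1 (proof, step (ii))] -/
theorem abs_heatKernel_sub_sub_heatKernel_le {t : ℝ} (ht : 0 < t) (x y : E) :
    |heatKernel t (x - y) - heatKernel t x| ≤
      (4 * π * t) ^ (-(Module.finrank ℝ E : ℝ) / 2) * (Real.sqrt t)⁻¹ * ‖y‖ := by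
  have hdiff : ∀ z ∈ (univ : Set E), DifferentiableAt ℝ (heatKernel (E := E) t) z :=
    fun z _ => (hasFDerivAt_heatKernel t z).differentiableAt
  have hbound : ∀ z ∈ (univ : Set E), ‖fderiv ℝ (heatKernel (E := E) t) z‖ ≤
      (4 * π * t) ^ (-(Module.finrank ℝ E : ℝ) / 2) * (Real.sqrt t)⁻¹ :=
    fun z _ => norm_fderiv_heatKernel_le_rpow ht z
  have h := convex_univ.norm_image_sub_le_of_norm_fderiv_le hdiff hbound (mem_univ x)
    (mem_univ (x - y))
  rwa [Real.norm_eq_abs, sub_sub_cancel_left, norm_neg] at h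

/-! ### First absolute moment: rate `t^{-1/2}` (Vázquez 2017, Theorem 4.1) -/

/-- The kernel integrand `y ↦ G_t(x - y) • f(y)` is integrable for `f ∈ L¹`, `t > 0`.
[cite: Vazquez2017, Theorem 4.1 (proof, step (ii))] -/
theorem integrable_heatKernel_sub_smul {f : E → F} (hf : Integrable f) {t : ℝ} (ht : 0 < t)
    (x : E) : Integrable fun y => heatKernel t (x - y) • f y := by
  have hφ : Continuous fun y : E => heatKernel t (x - y) :=
    (continuous_heatKernel t).comp (continuous_const.sub continuous_id)
  have h := hf.bdd_smul (φ := fun y : E => heatKernel t (x - y))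
    ((4 * π * t) ^ (-(Module.finrank ℝ E : ℝ) / 2)) hφ.aestronglyMeasurable
    (Eventually.of_forall fun y => by
      rw [Real.norm_of_nonneg (heatKernel_pos ht _).le]
      exact heatKernel_le ht _)
  exact h

/-- **Vázquez 2017, Theorem 4.1 (convergence to the Gaussian under a finite first absolute moment),
with the explicit constant `(4π)^{-N/2}`.** "Under the assumptions that `u₀ ∈ L¹(ℝᴺ)` and that the
first absolute moment is finite, `𝒩₁ = ∫|u₀(y)y|dy < ∞`, we get the convergence
`t^{N/2}|u(x, t) - MG_t(x)| ≤ C𝒩₁t^{-1/2}` … The rate `O(t^{-1/2})` is optimal under such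
assumptions." Typed for `f : E → F` integrable with `∫‖y‖‖f(y)‖dy < ∞`, `t > 0`, every `x`:
`‖e^{tΔ}f(x) - G_t(x)•∫f‖ ≤ (4πt)^{-n/2} t^{-1/2} ∫‖y‖‖f(y)‖dy`
(`u(x, t) - MG_t(x) = ∫(G_t(x - y) - G_t(x))f(y)dy` and the kernel increment).
[cite: Vazquez2017, Theorem 4.1] -/
theorem norm_heatExtension_sub_heatKernel_smul_integral_le {f : E → F} (hf : Integrable f)
    (hf1 : Integrable fun y => ‖y‖ * ‖f y‖) {t : ℝ} (ht : 0 < t) (x : E) :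
    ‖heatExtension f t x - heatKernel t x • ∫ y, f y‖ ≤
      (4 * π * t) ^ (-(Module.finrank ℝ E : ℝ) / 2) * (Real.sqrt t)⁻¹ * ∫ y, ‖y‖ * ‖f y‖ := by
  set C : ℝ := (4 * π * t) ^ (-(Module.finrank ℝ E : ℝ) / 2) * (Real.sqrt t)⁻¹ with hC
  have hci : Integrable fun y => heatKernel t x • f y := hf.smul (heatKernel t x)
  have hrepr : heatExtension f t x - heatKernel t x • ∫ y, f y =
      ∫ y, (heatKernel t (x - y) - heatKernel t x) • f y := by
    rw [heatExtension_eq_integral_sub, ← integral_smul,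
      ← integral_sub (integrable_heatKernel_sub_smul hf ht x) hci]
    exact integral_congr_ae (Eventually.of_forall fun y => by simp only [sub_smul])
  rw [hrepr, ← MeasureTheory.integral_const_mul]
  refine norm_integral_le_of_norm_le (hf1.const_mul C) (Eventually.of_forall fun y => ?_)
  rw [norm_smul, Real.norm_eq_abs, ← mul_assoc]
  exact mul_le_mul_of_nonneg_right (abs_heatKernel_sub_sub_heatKernel_le ht x y) (norm_nonneg _)

/-! ### The second-order kernel remainder -/

/-- **One-variable Taylor bound to second order** (the form of the Lagrange remainder used below):
if `φ` is twice differentiable on `ℝ` with `|φ''| ≤ L` on `[0, 1]`, then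
`|φ(1) - φ(0) - φ'(0)| ≤ L/2` (the functions `φ(s) - φ(0) - sφ'(0) ∓ (L/2)s²` are monotone on
`[0, 1]`). [cite: Vazquez2017, Theorem 5.1 (proof, step (i): Taylor's formula)] -/
theorem abs_sub_sub_deriv_le_of_abs_deriv_two_le {φ φ' φ'' : ℝ → ℝ} {L : ℝ}
    (h1 : ∀ s, HasDerivAt φ (φ' s) s) (h2 : ∀ s, HasDerivAt φ' (φ'' s) s)
    (hL : ∀ s ∈ Icc (0 : ℝ) 1, |φ'' s| ≤ L) :
    |φ 1 - φ 0 - φ' 0| ≤ L / 2 := by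
  -- the derivative is `L`-Lipschitz from `0` on `[0, 1]`
  have hφ' : ∀ s ∈ Icc (0 : ℝ) 1, |φ' s - φ' 0| ≤ L * s := by
    have h := norm_image_sub_le_of_norm_deriv_le_segment' (f := φ') (f' := φ'') (a := 0) (b := 1)
      (fun s _ => (h2 s).hasDerivWithinAt) (fun s hs => by
        rw [Real.norm_eq_abs]; exact hL s (Ico_subset_Icc_self hs))
    intro s hs
    have := h s hs
    rwa [Real.norm_eq_abs, sub_zero] at this
  have hcont : ∀ c : ℝ, ContinuousOn (fun s => φ s - φ 0 - s * φ' 0 + c * (s * s)) (Icc 0 1) :=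
    fun c => by
      have hφc : Continuous φ := continuous_iff_continuousAt.2 fun s => (h1 s).continuousAt
      fun_prop
  have hderiv : ∀ c s : ℝ, HasDerivAt (fun s => φ s - φ 0 - s * φ' 0 + c * (s * s))
      (φ' s - φ' 0 + c * (2 * s)) s := fun c s =>
    ((((h1 s).sub_const (φ 0)).sub ((hasDerivAt_id' s).mul_const (φ' 0))).add
      (((hasDerivAt_id' s).mul (hasDerivAt_id' s)).const_mul c)).congr_deriv (by ring)
  -- upper bound: `s ↦ φ s - φ 0 - sφ'(0) - (L/2)s²` is antitone on `[0, 1]`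
  have hup : φ 1 - φ 0 - φ' 0 ≤ L / 2 := by
    have hanti : AntitoneOn (fun s => φ s - φ 0 - s * φ' 0 + (-(L / 2)) * (s * s)) (Icc 0 1) := by
      refine antitoneOn_of_deriv_nonpos (convex_Icc 0 1) (hcont _)
        (fun s _ => (hderiv _ s).differentiableAt.differentiableWithinAt) fun s hs => ?_
      rw [interior_Icc] at hs
      rw [(hderiv _ s).deriv]
      have := (abs_le.1 (hφ' s (Ioo_subset_Icc_self hs))).2
      linarith
    have h10 : φ 1 - φ 0 - 1 * φ' 0 + (-(L / 2)) * (1 * 1) ≤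
        φ 0 - φ 0 - 0 * φ' 0 + (-(L / 2)) * (0 * 0) :=
      hanti (left_mem_Icc.2 zero_le_one) (right_mem_Icc.2 zero_le_one) zero_le_one
    linarith
  -- lower bound: `s ↦ φ s - φ 0 - sφ'(0) + (L/2)s²` is monotone on `[0, 1]`
  have hlow : -(L / 2) ≤ φ 1 - φ 0 - φ' 0 := by
    have hmono : MonotoneOn (fun s => φ s - φ 0 - s * φ' 0 + (L / 2) * (s * s)) (Icc 0 1) := by
      refine monotoneOn_of_deriv_nonneg (convex_Icc 0 1) (hcont _)
        (fun s _ => (hderiv _ s).differentiableAt.differentiableWithinAt) fun s hs => ?_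
      rw [interior_Icc] at hs
      rw [(hderiv _ s).deriv]
      have := (abs_le.1 (hφ' s (Ioo_subset_Icc_self hs))).1
      linarith
    have h10 : φ 0 - φ 0 - 0 * φ' 0 + (L / 2) * (0 * 0) ≤
        φ 1 - φ 0 - 1 * φ' 0 + (L / 2) * (1 * 1) :=
      hmono (left_mem_Icc.2 zero_le_one) (right_mem_Icc.2 zero_le_one) zero_le_one
    linarith
  exact abs_le.2 ⟨by linarith, by linarith⟩

/-- The elementary inequality behind the second-order remainder: `e^{-v}(v + ½) ≤ 1` for every
real `v` (`v + ½ ≤ 1 + v ≤ e^{v}`). [cite: Vazquez2017, Theorem 5.1 (proof, step (i): "the factor dependent on ξ is uniformly bounded")] -/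
theorem exp_neg_mul_add_half_le_one (v : ℝ) : Real.exp (-v) * (v + 1 / 2) ≤ 1 := by
  have h1 : v + 1 / 2 ≤ Real.exp v := by linarith [Real.add_one_le_exp v]
  calc Real.exp (-v) * (v + 1 / 2) ≤ Real.exp (-v) * Real.exp v :=
        mul_le_mul_of_nonneg_left h1 (Real.exp_pos _).le
    _ = 1 := by rw [← Real.exp_add, neg_add_cancel, Real.exp_zero]

omit [FiniteDimensional ℝ E] [MeasurableSpace E] [BorelSpace E] in
/-- **The second-order kernel remainder**: for `t > 0` and all `x, y`,
`|G_t(x - y) - G_t(x) - G_t(x)⟪x, y⟫/(2t)| ≤ (4πt)^{-n/2} ‖y‖²/(2t)`. Along `s ↦ x - sy` the kernel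
is `φ(s) = (4πt)^{-n/2}exp(-p(s)/4t)` with `p(s) = ‖x‖² - 2s⟪x, y⟫ + s²‖y‖² = ‖x - sy‖²`, so
`φ'(0) = G_t(x)⟪x, y⟫/(2t)` and `φ'' = φ·(p'²/(16t²) - ‖y‖²/(2t))` with `p'² ≤ 4p‖y‖²`, whence
`|φ''| ≤ (4πt)^{-n/2}(‖y‖²/t)·e^{-p/4t}(p/4t + ½) ≤ (4πt)^{-n/2}‖y‖²/t` — Vázquez's
`f''(s) = (-|y|²/2t + |⟨y, x - sy⟩|²/4t²)e^{-|x-sy|²/4t}`.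
[cite: Vazquez2017, Theorem 5.1 (proof, step (i))] -/
theorem abs_heatKernel_taylor_two_le {t : ℝ} (ht : 0 < t) (x y : E) :
    |heatKernel t (x - y) - heatKernel t x - heatKernel t x * (⟪x, y⟫ / (2 * t))| ≤
      (4 * π * t) ^ (-(Module.finrank ℝ E : ℝ) / 2) * t⁻¹ * ‖y‖ ^ 2 / 2 := by
  set c₀ : ℝ := (4 * π * t) ^ (-(Module.finrank ℝ E : ℝ) / 2) with hc₀
  have hc₀0 : 0 < c₀ := by positivity
  set a : ℝ := ⟪x, y⟫ with ha
  set b : ℝ := ‖y‖ ^ 2 with hb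
  set k : ℝ := -(1 / (4 * t)) with hk
  have hb0 : 0 ≤ b := by positivity
  -- the quadratic `p(s) = ‖x‖² - 2sa + s²b = ‖x - s•y‖²` and its derivative `p'(s) = -2a + 2sb`
  have hp_eq : ∀ s : ℝ, ‖x‖ ^ 2 - 2 * s * a + s * s * b = ‖x - s • y‖ ^ 2 := fun s => by
    rw [ha, hb, norm_sub_sq_real, inner_smul_right, norm_smul, mul_pow, Real.norm_eq_abs, sq_abs]
    ring
  have hp_nonneg : ∀ s : ℝ, 0 ≤ ‖x‖ ^ 2 - 2 * s * a + s * s * b := fun s => by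
    rw [hp_eq]; positivity
  have hp'_eq : ∀ s : ℝ, -2 * a + 2 * s * b = -2 * ⟪x - s • y, y⟫ := fun s => by
    rw [ha, hb, inner_sub_left, inner_smul_left, real_inner_self_eq_norm_sq]
    simp
    ring
  have hp : ∀ s : ℝ, HasDerivAt (fun s : ℝ => ‖x‖ ^ 2 - 2 * s * a + s * s * b)
      (-2 * a + 2 * s * b) s := fun s =>
    (((((hasDerivAt_id' s).const_mul (2 : ℝ)).mul_const a).const_sub (‖x‖ ^ 2)).add
      (((hasDerivAt_id' s).mul (hasDerivAt_id' s)).mul_const b)).congr_deriv (by ring)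
  have hp' : ∀ s : ℝ, HasDerivAt (fun s : ℝ => k * (-2 * a + 2 * s * b)) (k * (2 * b)) s :=
    fun s =>
    (((((hasDerivAt_id' s).const_mul (2 : ℝ)).mul_const b).const_add (-2 * a)).const_mul k).congr_deriv
      (by ring)
  -- the one-variable kernel `φ(s) = c₀ exp(k p(s))` and its first two derivatives
  have hφ : ∀ s : ℝ, HasDerivAt (fun s : ℝ => c₀ * Real.exp (k * (‖x‖ ^ 2 - 2 * s * a + s * s * b)))
      (c₀ * Real.exp (k * (‖x‖ ^ 2 - 2 * s * a + s * s * b)) * (k * (-2 * a + 2 * s * b))) s :=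
    fun s => ((((hp s).const_mul k).exp).const_mul c₀).congr_deriv (by ring)
  have hφ' : ∀ s : ℝ, HasDerivAt
      (fun s : ℝ => c₀ * Real.exp (k * (‖x‖ ^ 2 - 2 * s * a + s * s * b)) * (k * (-2 * a + 2 * s * b)))
      (c₀ * Real.exp (k * (‖x‖ ^ 2 - 2 * s * a + s * s * b)) *
        (k ^ 2 * (-2 * a + 2 * s * b) ^ 2 + k * (2 * b))) s := fun s =>
    ((hφ s).mul (hp' s)).congr_deriv (by ring)
  -- the bound `|φ''| ≤ c₀ b / t` on `[0, 1]` (indeed everywhere)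
  have hbound : ∀ s ∈ Icc (0 : ℝ) 1, |c₀ * Real.exp (k * (‖x‖ ^ 2 - 2 * s * a + s * s * b)) *
      (k ^ 2 * (-2 * a + 2 * s * b) ^ 2 + k * (2 * b))| ≤ c₀ * t⁻¹ * b := by
    intro s _
    set P : ℝ := ‖x‖ ^ 2 - 2 * s * a + s * s * b with hP
    have hP0 : 0 ≤ P := hp_nonneg s
    -- Cauchy–Schwarz: `p'(s)² ≤ 4 p(s) b`
    have hCS : (-2 * a + 2 * s * b) ^ 2 ≤ 4 * P * b := by
      rw [hp'_eq s, hP, hp_eq s, hb]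
      have h1 := abs_real_inner_le_norm (x - s • y) y
      have h2 : ⟪x - s • y, y⟫ ^ 2 ≤ (‖x - s • y‖ * ‖y‖) ^ 2 := by
        rw [← sq_abs]; exact pow_le_pow_left₀ (abs_nonneg _) h1 2
      nlinarith [h2]
    have hφs : 0 < c₀ * Real.exp (k * P) := mul_pos hc₀0 (Real.exp_pos _)
    have hkey := exp_neg_mul_add_half_le_one (P / (4 * t))
    have hkP : k * P = -(P / (4 * t)) := by rw [hk]; ring
    calc |c₀ * Real.exp (k * P) * (k ^ 2 * (-2 * a + 2 * s * b) ^ 2 + k * (2 * b))|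
        = c₀ * Real.exp (k * P) * |k ^ 2 * (-2 * a + 2 * s * b) ^ 2 + k * (2 * b)| := by
          rw [abs_mul, abs_of_pos hφs]
      _ ≤ c₀ * Real.exp (k * P) * (k ^ 2 * (4 * P * b) + |k| * (2 * b)) := by
          refine mul_le_mul_of_nonneg_left ?_ hφs.le
          refine (abs_add_le _ _).trans ?_
          rw [abs_mul, abs_mul, abs_of_nonneg (sq_nonneg k), abs_of_nonneg (sq_nonneg _),
            abs_of_nonneg (by positivity : (0 : ℝ) ≤ 2 * b)]
          gcongr
      _ = c₀ * t⁻¹ * b * (Real.exp (-(P / (4 * t))) * (P / (4 * t) + 1 / 2)) := by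
          rw [hkP, hk, abs_neg, abs_of_pos (by positivity : (0 : ℝ) < 1 / (4 * t))]
          field_simp
          ring
      _ ≤ c₀ * t⁻¹ * b * 1 := by gcongr
      _ = c₀ * t⁻¹ * b := mul_one _
  -- Taylor to second order on `[0, 1]`
  have hmain := abs_sub_sub_deriv_le_of_abs_deriv_two_le hφ hφ' hbound
  -- identify the three values with the kernel
  have hk1 : ∀ s : ℝ, k * (‖x‖ ^ 2 - 2 * s * a + s * s * b) = -(1 / (4 * t)) * ‖x - s • y‖ ^ 2 :=
    fun s => by rw [hp_eq]
  have e1 : c₀ * Real.exp (k * (‖x‖ ^ 2 - 2 * 1 * a + 1 * 1 * b)) = heatKernel t (x - y) := by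
    rw [hk1, one_smul, heatKernel_eq]
  have e0 : c₀ * Real.exp (k * (‖x‖ ^ 2 - 2 * 0 * a + 0 * 0 * b)) = heatKernel t x := by
    rw [hk1, zero_smul, sub_zero, heatKernel_eq]
  have e0' : k * (-2 * a + 2 * 0 * b) = ⟪x, y⟫ / (2 * t) := by
    rw [hk, ha]; field_simp; ring
  rw [e0', e0, e1] at hmain
  calc |heatKernel t (x - y) - heatKernel t x - heatKernel t x * (⟪x, y⟫ / (2 * t))|
      ≤ c₀ * t⁻¹ * b / 2 := hmain
    _ = c₀ * t⁻¹ * ‖y‖ ^ 2 / 2 := by rw [hb]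

/-! ### Second moment, centred data: rate `t^{-1}` (Vázquez 2017, Theorem 5.1) -/

/-- **Vázquez 2017, Theorem 5.1 (improved convergence under a finite second moment), centred form,
with the explicit constant `(4π)^{-N/2}/2`.** "Under the assumptions that `u₀ ∈ L¹(ℝᴺ)` and that the
signed first moment `𝒩_{1,i} = ∫y_iu₀(y)dy` is finite (for all coordinates), as well as the second
moment `𝒩₂ = ∫y²|u₀|(y)dy < ∞`, we get the convergence
`t^{N/2}|u(x, t) - MG_t(x) + Σ_i𝒩_{1,i}∂_{x_i}G_t(x)| ≤ C𝒩₂t^{-1}` … The rate `O(t^{-1})` is optimal …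
When `x_c` is finite and `M ≠ 0`, the center of mass can be reduced to zero by just a displacement of
the spatial axis." Typed for CENTRED data — every first signed moment vanishes,
`∫⟪v, y⟫•f(y)dy = 0` for all `v` — for which the dipole term is absent: for `f : E → F` integrable
with `∫‖y‖²‖f(y)‖dy < ∞`, `t > 0` and every `x`,
`‖e^{tΔ}f(x) - G_t(x)•∫f‖ ≤ (4πt)^{-n/2} (2t)⁻¹ ∫‖y‖²‖f(y)‖dy`
(`∫(G_t(x - y) - G_t(x) - G_t(x)⟪x, y⟫/2t)•f(y)dy` and `abs_heatKernel_taylor_two_le`).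
[cite: Vazquez2017, Theorem 5.1] -/
theorem norm_heatExtension_sub_heatKernel_smul_integral_le_of_centred {f : E → F}
    (hf : Integrable f) (hf2 : Integrable fun y => ‖y‖ ^ 2 * ‖f y‖)
    (hc : ∀ v : E, ∫ y, ⟪v, y⟫ • f y = 0) {t : ℝ} (ht : 0 < t) (x : E) :
    ‖heatExtension f t x - heatKernel t x • ∫ y, f y‖ ≤
      (4 * π * t) ^ (-(Module.finrank ℝ E : ℝ) / 2) * (2 * t)⁻¹ * ∫ y, ‖y‖ ^ 2 * ‖f y‖ := by
  set c₀ : ℝ := (4 * π * t) ^ (-(Module.finrank ℝ E : ℝ) / 2) with hc₀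
  -- the first-moment integrand is integrable (`‖y‖ ≤ (1 + ‖y‖²)/2`) and integrates to zero
  have hlin_int : Integrable fun y => (heatKernel t x * (⟪x, y⟫ / (2 * t))) • f y := by
    have hmeas : AEStronglyMeasurable (fun y => (heatKernel t x * (⟪x, y⟫ / (2 * t))) • f y)
        volume := by
      refine AEStronglyMeasurable.smul ?_ hf.aestronglyMeasurable
      exact (continuous_const.mul ((continuous_const.inner continuous_id).div_const _)).aestronglyMeasurable
    refine Integrable.mono' ((hf.norm.add hf2).const_mul (|heatKernel t x| * ‖x‖ / (2 * t))) hmeas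
      (Eventually.of_forall fun y => ?_)
    rw [norm_smul, Real.norm_eq_abs, abs_mul, abs_div, abs_of_pos (by positivity : (0:ℝ) < 2 * t)]
    have h1 : |⟪x, y⟫| ≤ ‖x‖ * ‖y‖ := abs_real_inner_le_norm x y
    have h2 : ‖y‖ ≤ 1 + ‖y‖ ^ 2 := by nlinarith [norm_nonneg y, sq_nonneg (‖y‖ - 1)]
    have h3 : |⟪x, y⟫| * ‖f y‖ ≤ ‖x‖ * (‖f y‖ + ‖y‖ ^ 2 * ‖f y‖) := by
      calc |⟪x, y⟫| * ‖f y‖ ≤ ‖x‖ * ‖y‖ * ‖f y‖ := by gcongr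
        _ ≤ ‖x‖ * (1 + ‖y‖ ^ 2) * ‖f y‖ := by gcongr
        _ = ‖x‖ * (‖f y‖ + ‖y‖ ^ 2 * ‖f y‖) := by ring
    calc |heatKernel t x| * (|⟪x, y⟫| / (2 * t)) * ‖f y‖
        = |heatKernel t x| / (2 * t) * (|⟪x, y⟫| * ‖f y‖) := by ring
      _ ≤ |heatKernel t x| / (2 * t) * (‖x‖ * (‖f y‖ + ‖y‖ ^ 2 * ‖f y‖)) := by gcongr
      _ = |heatKernel t x| * ‖x‖ / (2 * t) * (‖f y‖ + ‖y‖ ^ 2 * ‖f y‖) := by ring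
  have hlin_zero : ∫ y, (heatKernel t x * (⟪x, y⟫ / (2 * t))) • f y = 0 := by
    have : (fun y => (heatKernel t x * (⟪x, y⟫ / (2 * t))) • f y) =
        fun y => (heatKernel t x / (2 * t)) • (⟪x, y⟫ • f y) := by
      funext y; rw [smul_smul]; congr 1; ring
    rw [this, integral_smul, hc x, smul_zero]
  -- representation of the difference through the second-order remainder
  have hrepr : heatExtension f t x - heatKernel t x • ∫ y, f y =
      ∫ y, (heatKernel t (x - y) - heatKernel t x - heatKernel t x * (⟪x, y⟫ / (2 * t))) • f y := by
    have hci : Integrable fun y => heatKernel t x • f y := hf.smul (heatKernel t x)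
    have hdi : Integrable fun y => (heatKernel t (x - y) - heatKernel t x) • f y :=
      ((integrable_heatKernel_sub_smul hf ht x).sub hci).congr
        (Eventually.of_forall fun y => by simp only [Pi.sub_apply, sub_smul])
    have h1 : heatExtension f t x - heatKernel t x • ∫ y, f y =
        ∫ y, (heatKernel t (x - y) - heatKernel t x) • f y := by
      rw [heatExtension_eq_integral_sub, ← integral_smul,
        ← integral_sub (integrable_heatKernel_sub_smul hf ht x) hci]
      exact integral_congr_ae (Eventually.of_forall fun y => by simp only [sub_smul])
    rw [h1, ← sub_zero (∫ y, (heatKernel t (x - y) - heatKernel t x) • f y), ← hlin_zero,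
      ← integral_sub hdi hlin_int]
    exact integral_congr_ae (Eventually.of_forall fun y => by simp only [sub_smul])
  rw [hrepr, ← MeasureTheory.integral_const_mul]
  refine norm_integral_le_of_norm_le (hf2.const_mul _) (Eventually.of_forall fun y => ?_)
  rw [norm_smul, Real.norm_eq_abs]
  calc |heatKernel t (x - y) - heatKernel t x - heatKernel t x * (⟪x, y⟫ / (2 * t))| * ‖f y‖
      ≤ c₀ * t⁻¹ * ‖y‖ ^ 2 / 2 * ‖f y‖ :=
        mul_le_mul_of_nonneg_right (abs_heatKernel_taylor_two_le ht x y) (norm_nonneg _)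
    _ = c₀ * (2 * t)⁻¹ * (‖y‖ ^ 2 * ‖f y‖) := by
        rw [mul_inv]
        ring

/-- Even data are centred: if `f(-y) = f(y)` for all `y` then `∫⟪v, y⟫•f(y)dy = 0` for every `v`
(the substitution `y ↦ -y` reverses the sign of the integral). [cite: Vazquez2017, Theorem 5.1 (Reformulation: "the first moment can be eliminated")] -/
theorem integral_inner_smul_eq_zero_of_even {f : E → F} (heven : ∀ y, f (-y) = f y) (v : E) :
    ∫ y, ⟪v, y⟫ • f y = 0 := by
  have h := integral_neg_eq_self (fun y => ⟪v, y⟫ • f y) (volume : Measure E)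
  simp only [inner_neg_right, heven, neg_smul, integral_neg] at h
  -- `h : -I = I`
  have h2 : (2 : ℝ) • ∫ y, ⟪v, y⟫ • f y = 0 := by rw [two_smul]; nth_rw 1 [← h]; exact neg_add_cancel _
  exact (smul_eq_zero.1 h2).resolve_left two_ne_zero

/-- **Theorem 5.1 for even data** (`f(-y) = f(y)`, in particular radial data): for `f : E → F`
integrable and even with `∫‖y‖²‖f(y)‖dy < ∞`, `t > 0` and every `x`,
`‖e^{tΔ}f(x) - G_t(x)•∫f‖ ≤ (4πt)^{-n/2} (2t)⁻¹ ∫‖y‖²‖f(y)‖dy`.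
[cite: Vazquez2017, Theorem 5.1] -/
theorem norm_heatExtension_sub_heatKernel_smul_integral_le_of_even {f : E → F}
    (hf : Integrable f) (hf2 : Integrable fun y => ‖y‖ ^ 2 * ‖f y‖) (heven : ∀ y, f (-y) = f y)
    {t : ℝ} (ht : 0 < t) (x : E) :
    ‖heatExtension f t x - heatKernel t x • ∫ y, f y‖ ≤
      (4 * π * t) ^ (-(Module.finrank ℝ E : ℝ) / 2) * (2 * t)⁻¹ * ∫ y, ‖y‖ ^ 2 * ‖f y‖ :=
  norm_heatExtension_sub_heatKernel_smul_integral_le_of_centred hf hf2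
    (integral_inner_smul_eq_zero_of_even heven) ht x

end Literature.Analysis.UnboundedOperators
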